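import Literature.Geometry.Lorentzian.BogovskiiVectorPointwise
import Literature.Geometry.Lorentzian.BogovskiiL2Bound
import HarnessLib

/-!
# `L²`-boundedness of the vector Bogovskiĭ-type operator `SV_η` on densities supported in a ball

(trunk G08 = T-LORENTZ; family `gr`; namespace `Literature.Geometry.Lorentzian.MaoOhTao`.)

Mao–Oh–Tao (arXiv:2308.13031), Lemma 2.3 (T3): `T(χ_Ω ·) : H^{s'} → H^{s'+1}`.  The order-`0` content for the vector
building block `(SV_η g)^a(x) = ∫ w_y (x − y)_a/|x − y|³ g(y) dy` of `T_η` (`bogovskiiSV`): the kernel obeys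
`|V^a(x, y)| ≤ W/|x − y|²` on `|x − y| ≤ R + ρ` and vanishes beyond (`|y| ≤ ρ`), an integrable majorant in `ℝ³`, so
Schur's test (`Literature.Analysis.SingularIntegrals`) gives `∫ |(SV_η g)^a|² ≤ C ∫ |g|²` for continuous `g` supported
in `B̄_ρ` (`exists_l2Const_bogovskiiSV`).  (The tensor `T_η F` also involves `∂_m S_η F_k`, bounded in `L²` by
`BogovskiiH1Bound.lean`.)

## References

* Y. Mao, S.-J. Oh, T. Tao, arXiv:2308.13031 (2023), Lemma 2.3 (T3), pp. 8–9 (key `MaoOhTao2023`).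
-/

noncomputable section

open scoped RealInnerProductSpace Topology ENNReal
open Filter MeasureTheory Set Metric Function

namespace Literature.Geometry.Lorentzian

namespace MaoOhTao

variable {η : E3 → ℝ} {R : ℝ}

/-- The vector kernel in classical form, `(x − y)_a ∫_1^∞ η(s(x − y) + y) s² ds`, is measurable on `ℝ³ × ℝ³`.
[folklore] -/
theorem measurable_classicalVKernel (hη : Continuous η) (a : Fin 3) :
    Measurable fun p : E3 × E3 ↦ (p.1 - p.2) a * ∫ s in Ioi (1 : ℝ), η (s • (p.1 - p.2) + p.2) * s ^ 2 := by
  have hsub : Continuous fun p : E3 × E3 ↦ p.1 - p.2 := continuous_fst.sub continuous_snd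
  have h1 : Measurable fun p : E3 × E3 ↦ (p.1 - p.2) a :=
    ((EuclideanSpace.proj (𝕜 := ℝ) a).continuous.comp hsub).measurable
  have h2 : StronglyMeasurable fun p : E3 × E3 ↦ ∫ s in Ioi (1 : ℝ), η (s • (p.1 - p.2) + p.2) * s ^ 2 := by
    have hc : Continuous fun q : (E3 × E3) × ℝ ↦ η (q.2 • (q.1.1 - q.1.2) + q.1.2) * q.2 ^ 2 :=
      (hη.comp ((continuous_snd.smul (hsub.comp continuous_fst)).add
        (continuous_snd.comp continuous_fst))).mul (continuous_snd.pow 2)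
    exact hc.stronglyMeasurable.integral_prod_right' (ν := (volume : Measure ℝ).restrict (Ioi 1))
  exact h1.mul h2.measurable

/-- The vector kernel is dominated by the translation-invariant majorant: for `|y| ≤ ρ`,
`|V^a_η(x, y)| ≤ W 𝟙_{|x−y| ≤ R+ρ}/|x − y|²`. [folklore] -/
theorem abs_classicalVKernel_le (hR : ∀ z : E3, R < ‖z‖ → η z = 0) {W ρ : ℝ} (hW0 : 0 ≤ W)
    (hW : ∀ y : E3, ‖y‖ ≤ ρ → ∀ (r : ℝ) (α : E3), ‖α‖ = 1 → |bogovskiiWeight η y r α| ≤ W)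
    {y : E3} (hy : ‖y‖ ≤ ρ) (x : E3) (a : Fin 3) :
    |(x - y) a * ∫ s in Ioi (1 : ℝ), η (s • (x - y) + y) * s ^ 2| ≤
      (closedBall (0 : E3) (R + ρ)).indicator (fun z ↦ W * (‖z‖ ^ 2)⁻¹) (x - y) := by
  rw [← bogovskiiV_eq_classical η y (x - y) a]
  set z := x - y with hz
  by_cases hz0 : z = 0
  · rw [hz0]
    simp only [PiLp.zero_apply, zero_mul, mul_zero, abs_zero]
    exact indicator_nonneg (fun w _ ↦ by positivity) _
  have hn : 0 < ‖z‖ := norm_pos_iff.2 hz0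
  have hα : ‖‖z‖⁻¹ • z‖ = 1 := by rw [norm_smul, norm_inv, norm_norm, inv_mul_cancel₀ hn.ne']
  by_cases hzD : z ∈ closedBall (0 : E3) (R + ρ)
  · rw [indicator_of_mem hzD, abs_mul]
    exact mul_le_mul (hW y hy _ _ hα) (abs_vkernel_le z a) (abs_nonneg _) hW0
  · rw [indicator_of_notMem hzD]
    rw [mem_closedBall, dist_zero_right, not_le] at hzD
    have hw : bogovskiiWeight η y ‖z‖ (‖z‖⁻¹ • z) = 0 :=
      bogovskiiWeight_eq_zero_of_le hR hα (by linarith)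
    rw [hw, zero_mul, abs_zero]

/-- The Schur majorant `W 𝟙_{|z| ≤ D}/|z|²` has finite integral. [folklore] -/
theorem lintegral_vmajorant_lt_top (W D : ℝ) :
    ∫⁻ z : E3, ENNReal.ofReal ((closedBall (0 : E3) D).indicator (fun z ↦ W * (‖z‖ ^ 2)⁻¹) z) < ⊤ := by
  have h := (integrable_indicator_inv_norm_sq W D).hasFiniteIntegral
  rw [hasFiniteIntegral_iff_enorm] at h
  exact lt_of_le_of_lt (lintegral_mono fun z ↦ Real.ofReal_le_enorm _) h

/-- **`L²`-boundedness of `SV_η` on `L²(B̄_ρ)`** (order-`0` part of (T3), by Schur's test). [cite: MaoOhTao2023, Lemma 2.3 (T3)] -/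
theorem exists_l2Const_bogovskiiSV (hη : Continuous η) (hR : ∀ z : E3, R < ‖z‖ → η z = 0) (ρ : ℝ) :
    ∃ C : ℝ≥0∞, C < ⊤ ∧ ∀ (g : E3 → ℝ), Continuous g → (∀ y, g y ≠ 0 → ‖y‖ ≤ ρ) → ∀ a : Fin 3,
      ∫⁻ x : E3, ‖bogovskiiSV η g a x‖ₑ ^ (2 : ℝ) ≤ C * ∫⁻ y : E3, ‖g y‖ₑ ^ (2 : ℝ) := by
  obtain ⟨W, hW⟩ := exists_abs_bogovskiiWeight_le_of_norm_le hη hR ρ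
  set k : E3 → ℝ≥0∞ := fun z ↦ ENNReal.ofReal ((closedBall (0 : E3) (R + ρ)).indicator
    (fun z ↦ max W 0 * (‖z‖ ^ 2)⁻¹) z) with hk
  set Ck : ℝ≥0∞ := ∫⁻ z : E3, k z with hCk
  have hCk_top : Ck < ⊤ := lintegral_vmajorant_lt_top _ _
  refine ⟨Ck ^ ((2 : ℝ) / 2) * Ck, ENNReal.mul_lt_top (ENNReal.rpow_lt_top_of_nonneg (by norm_num) hCk_top.ne)
    hCk_top, fun g hg hgρ a ↦ ?_⟩
  set K : E3 → E3 → ℝ≥0∞ := fun x y ↦ ‖(x - y) a * ∫ s in Ioi (1 : ℝ), η (s • (x - y) + y) * s ^ 2‖ₑ *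
    (closedBall (0 : E3) ρ).indicator 1 y with hKdef
  have hKm : Measurable (uncurry K) := by
    refine (measurable_classicalVKernel hη a).enorm.mul ?_
    exact (measurable_one.indicator measurableSet_closedBall).comp measurable_snd
  have hKle : ∀ x y, K x y ≤ k (x - y) := by
    intro x y
    by_cases hy : y ∈ closedBall (0 : E3) ρ
    · have hy' : ‖y‖ ≤ ρ := by rwa [mem_closedBall, dist_zero_right] at hy
      simp only [hKdef, hk, indicator_of_mem hy, Pi.one_apply, mul_one]
      rw [Real.enorm_eq_ofReal_abs]
      exact ENNReal.ofReal_le_ofReal (abs_classicalVKernel_le hR (le_max_right _ _)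
        (fun y hy r α hα ↦ (hW y hy r α hα).trans (le_max_left _ _)) hy' x a)
    · simp only [hKdef, indicator_of_notMem hy, mul_zero]
      exact bot_le
  have hrow : ∀ᵐ x ∂(volume : Measure E3), ∫⁻ y, K x y * (1 : ℝ≥0∞) ^ (2 : ℝ) ≤ Ck * (1 : ℝ≥0∞) ^ (2 : ℝ) := by
    refine ae_of_all _ fun x ↦ ?_
    simp only [ENNReal.one_rpow, mul_one]
    calc ∫⁻ y, K x y ≤ ∫⁻ y, k (x - y) := lintegral_mono fun y ↦ hKle x y
      _ = Ck := by rw [hCk, lintegral_sub_left_eq_self k x]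
  have hcol : ∀ᵐ y ∂(volume : Measure E3), ∫⁻ x, K x y * (1 : ℝ≥0∞) ^ (2 : ℝ) ≤ Ck * (1 : ℝ≥0∞) ^ (2 : ℝ) := by
    refine ae_of_all _ fun y ↦ ?_
    simp only [ENNReal.one_rpow, mul_one]
    calc ∫⁻ x, K x y ≤ ∫⁻ x, k (x - y) := lintegral_mono fun x ↦ hKle x y
      _ = Ck := by rw [hCk, lintegral_sub_right_eq_self k y]
  have hschur := Literature.Analysis.SingularIntegrals.lintegral_rpow_lintegral_le_of_schur
    (μ := (volume : Measure E3)) (ν := (volume : Measure E3)) (p := 2) (q := 2) Real.HolderConjugate.two_two hKm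
    measurable_const measurable_const (ae_of_all _ fun _ ↦ one_ne_zero) (ae_of_all _ fun _ ↦ ENNReal.one_ne_top)
    hrow hcol (f := fun y ↦ ‖g y‖ₑ) hg.measurable.enorm
  refine le_trans (lintegral_mono fun x ↦ ?_) hschur
  refine ENNReal.rpow_le_rpow ?_ (by norm_num)
  rw [bogovskiiSV_apply]
  refine (enorm_integral_le_lintegral_enorm _).trans (lintegral_mono fun y ↦ ?_)
  rw [bogovskiiV_eq_classical η y (x - y) a, enorm_mul]
  by_cases hgy : g y = 0
  · simp [hgy]
  · have hy : y ∈ closedBall (0 : E3) ρ := by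
      rw [mem_closedBall, dist_zero_right]; exact hgρ y hgy
    simp only [hKdef, indicator_of_mem hy, Pi.one_apply, mul_one, le_refl]

end MaoOhTao

end Literature.Geometry.Lorentzian

end
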